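import Summits.QuantumFields.YangMills.Theorems.FlatTubeReductionFibredBOBlocks
import HarnessLib

/-!
# Fibred Born–Oppenheimer blocks — part 3: the fibred KERNEL on `X = C × Q` and the identification «kernel form = Gram form»
# (route `FlatTubeReduction`, crux K1 `NearFlatRatioLaw` stmt-QuantumFields-24720, registered stub `stub_boRate` = FCL 23943's `BORateAll`;
# rung R2b1 = RECORD-label femto gap; no summit statement is proved here)

Seat `ym-line-ftr-p1` g6 (prover).  Parts 1–2 (`…FibredBOBlocks`, `…FibredBOCross`) prove the Born–Oppenheimer blocks for the fibred form written in
GRAM form, `T(Φ,Ψ) = ∫∫ k(c,c')·∫ (S_cΦ_c)(z)(S_{c'}Ψ_{c'})(z) dρ`.  A transfer operator, however, comes as a KERNEL on `X = C × Q` (slow × fast) with the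
product a-priori measure `ν ⊗ π` (route RED lane A: ★★★ `integral_configMeasure_slowChart`), and its quadratic form as `∫_x ∫_{x'} Φ(x)K(x,x')Ψ(x')` — the
shape in which lane A's comparison lemmas (`…InnerKernelComparison`, `…KernelParity`) are stated.  This file closes the gap:
* `gramKernel`, `fibredKernel` — `G_{c,c'}(q,q') = ∫ s(c,q,z)s(c',q',z)dρ` and `K((c,q),(c',q')) = k(c,c')·G_{c,c'}(q,q')`;
* ★ `integral_gramKernel_eq_fibrePair` — fibre level: `∫∫ φ(q)G_{c,c'}(q,q')ψ(q') dπdπ = B_{c,c'}(φ,ψ)` (Fubini over `(q,q',z)` + `∫∫ f(q)g(q') = ∫f·∫g`);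
* ★ `fibredForm_eq_iterated` — `T(Φ,Ψ) = ∫_c∫_{c'}∫_q∫_{q'} Φ(c,q)K((c,q),(c',q'))Ψ(c',q')`;
* `shuffle`, `measurePreserving_shuffle` — the measurable shuffle `((c,q),(c',q')) ↦ ((c,c'),(q,q'))` sends `(ν⊗π)⊗(ν⊗π)` to `(ν⊗ν)⊗(π⊗π)`;
* ★ `integral_integral_prod_eq_iterated₄` — `∫_x∫_{x'} F(x,x') d(ν⊗π)d(ν⊗π) = ∫_c∫_{c'}∫_q∫_{q'} F((c,q),(c',q'))` for `F` integrable on `X × X`;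
* ★★ `integral_fibredKernel_eq_fibredForm` — `∫_x∫_{x'} Φ(x)K(x,x')Ψ(x') = T(Φ,Ψ)`: the MASTER / DIAG / STIFF / CROSS blocks apply to the kernel operator.
Integrability side conditions are hypotheses (kernel integrand on `X × X`; Gram integrand on `(Q × Q) × Z` fibre by fibre).  HONEST FRAMING: Fubini
bookkeeping for the registered stub of a crux of the CONDITIONAL reduction route to the femto rung R2b1 (RECORD label); the chart supplying `k, s` for the
lattice transfer operator is OPEN (route RED lane A C4-CORE + the rate twin, `Cruxes/NearFlatRatioLaw/Lines/borate.md`); nothing here is infinite volume, a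
continuum limit or the Clay mass gap.  No named facts, no `sorry`.

## References
* B. Helffer, *Spectral Theory and its Applications*, CUP 2013, §7.1 (transfer operators as integral kernels) — [cite: Helffer2013, §7.1 pp.77–78].
-/

set_option autoImplicit false

noncomputable section

open MeasureTheory

namespace Summit.QuantumFields.YangMills.Theorems.FemtoTransferGap.FibredBO

variable {C Q Z : Type*} [MeasurableSpace C] [MeasurableSpace Q] [MeasurableSpace Z]


section DefsK
variable (ρ : Measure Z) (k : C → C → ℝ) (s : C → Q → Z → ℝ)

/-- The kinetic GRAM kernel between the fibres over `c` and `c'`: `G_{c,c'}(q,q') = ∫ s(c,q,z)·s(c',q',z) dρ(z)`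
(for `s(c,q,z) = m_c(q)·g(q−z)` with a Gaussian `g` this is `m_c(q)·(g∗g)(q−q')·m_{c'}(q')`). -/
def gramKernel (c c' : C) (q q' : Q) : ℝ := ∫ z, s c q z * s c' q' z ∂ρ

/-- The FIBRED kernel on `X = C × Q`: `K(x,x') = k(c,c')·G_{c,c'}(q,q')`. -/
def fibredKernel (x x' : C × Q) : ℝ := k x.1 x'.1 * gramKernel ρ s x.1 x'.1 x.2 x'.2

end DefsK

variable {ν : Measure C} {π : Measure Q} {ρ : Measure Z} [SFinite ν] [SFinite π] [SFinite ρ]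
variable {k : C → C → ℝ} {s : C → Q → Z → ℝ}

omit [MeasurableSpace C] in
/-- ★ **Fibre level**: for fixed slow points `c, c'`, the kernel form of the Gram kernel is the Gram pairing of the half-transforms:
`∫∫ φ(q)·G_{c,c'}(q,q')·ψ(q') dπ dπ = B_{c,c'}(φ,ψ)` (Fubini over `(q,q',z)`; the product-integrability of `(s_cφ)(q,z)·(s_{c'}ψ)(q',z)` is assumed). [folklore] -/
theorem integral_gramKernel_eq_fibrePair (c c' : C) (φ ψ : Q → ℝ)
    (hG : Integrable (fun w : (Q × Q) × Z => (s c w.1.1 w.2 * φ w.1.1) * (s c' w.1.2 w.2 * ψ w.1.2)) ((π.prod π).prod ρ)) :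
    ∫ q, ∫ q', φ q * gramKernel ρ s c c' q q' * ψ q' ∂π ∂π = fibrePair π ρ s c c' φ ψ := by
  set g : (Q × Q) × Z → ℝ := fun w => (s c w.1.1 w.2 * φ w.1.1) * (s c' w.1.2 w.2 * ψ w.1.2) with hg
  -- pull `φ q`, `ψ q'` inside the `z`-integral
  have e1 : ∀ q q', φ q * gramKernel ρ s c c' q q' * ψ q' = ∫ z, g ((q, q'), z) ∂ρ := by
    intro q q'
    unfold gramKernel
    rw [← integral_const_mul, ← integral_mul_const]
    refine integral_congr_ae (ae_of_all _ fun z => ?_)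
    simp only [hg]
    ring
  have e2 : (fun q => ∫ q', φ q * gramKernel ρ s c c' q q' * ψ q' ∂π) = fun q => ∫ q', ∫ z, g ((q, q'), z) ∂ρ ∂π := by
    funext q
    exact integral_congr_ae (ae_of_all _ fun q' => e1 q q')
  rw [e2]
  -- (q, q') iterated → product, then the whole thing → product, then z outermost
  have h1 : ∫ q, ∫ q', ∫ z, g ((q, q'), z) ∂ρ ∂π ∂π = ∫ w, ∫ z, g (w, z) ∂ρ ∂(π.prod π) :=
    (integral_prod (fun w : Q × Q => ∫ z, g (w, z) ∂ρ) hG.integral_prod_left).symm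
  have h2 : ∫ w, ∫ z, g (w, z) ∂ρ ∂(π.prod π) = ∫ p, g p ∂((π.prod π).prod ρ) := (integral_prod g hG).symm
  have h3 : ∫ p, g p ∂((π.prod π).prod ρ) = ∫ z, ∫ w, g (w, z) ∂(π.prod π) ∂ρ := integral_prod_symm g hG
  rw [h1, h2, h3]
  -- the `(q,q')`-integral of a product splits
  unfold fibrePair halfT
  refine integral_congr_ae (ae_of_all _ fun z => ?_)
  have h4 : ∫ w, g (w, z) ∂(π.prod π) = ∫ w : Q × Q, (s c w.1 z * φ w.1) * (s c' w.2 z * ψ w.2) ∂(π.prod π) :=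
    integral_congr_ae (ae_of_all _ fun w => rfl)
  show ∫ w, g (w, z) ∂(π.prod π) = (∫ q, s c q z * φ q ∂π) * ∫ q, s c' q z * ψ q ∂π
  rw [h4]
  exact integral_prod_mul (μ := π) (ν := π) (fun q => s c q z * φ q) (fun q' => s c' q' z * ψ q')

omit [SFinite ν] in
/-- ★ **Slow level**: the fibred form is the iterated kernel form in the order `c, c', q, q'`:
`T(Φ,Ψ) = ∫_c ∫_{c'} ∫_q ∫_{q'} Φ(c,q)·K((c,q),(c',q'))·Ψ(c',q')`. [folklore] -/
theorem fibredForm_eq_iterated (Φ Ψ : C × Q → ℝ)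
    (hG : ∀ c c', Integrable (fun w : (Q × Q) × Z => (s c w.1.1 w.2 * Φ (c, w.1.1)) * (s c' w.1.2 w.2 * Ψ (c', w.1.2))) ((π.prod π).prod ρ)) :
    fibredForm ν π ρ k s Φ Ψ =
      ∫ c, ∫ c', ∫ q, ∫ q', Φ (c, q) * fibredKernel ρ k s (c, q) (c', q') * Ψ (c', q') ∂π ∂π ∂ν ∂ν := by
  unfold fibredForm
  refine integral_congr_ae (ae_of_all _ fun c => integral_congr_ae (ae_of_all _ fun c' => ?_))
  have e : ∫ q, ∫ q', Φ (c, q) * fibredKernel ρ k s (c, q) (c', q') * Ψ (c', q') ∂π ∂π =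
      k c c' * ∫ q, ∫ q', Φ (c, q) * gramKernel ρ s c c' q q' * Ψ (c', q') ∂π ∂π := by
    rw [← integral_const_mul]
    refine integral_congr_ae (ae_of_all _ fun q => ?_)
    show ∫ q', Φ (c, q) * fibredKernel ρ k s (c, q) (c', q') * Ψ (c', q') ∂π = k c c' * ∫ q', Φ (c, q) * gramKernel ρ s c c' q q' * Ψ (c', q') ∂π
    rw [← integral_const_mul]
    refine integral_congr_ae (ae_of_all _ fun q' => ?_)
    show Φ (c, q) * fibredKernel ρ k s (c, q) (c', q') * Ψ (c', q') = k c c' * (Φ (c, q) * gramKernel ρ s c c' q q' * Ψ (c', q'))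
    unfold fibredKernel
    ring
  show k c c' * fibrePair π ρ s c c' (fun q => Φ (c, q)) (fun q => Ψ (c', q)) =
    ∫ q, ∫ q', Φ (c, q) * fibredKernel ρ k s (c, q) (c', q') * Ψ (c', q') ∂π ∂π
  rw [e]
  congr 1
  exact (integral_gramKernel_eq_fibrePair c c' (fun q => Φ (c, q)) (fun q => Ψ (c', q)) (hG c c')).symm

/-! ### The reshuffle `((c,q),(c',q')) ↦ ((c,c'),(q,q'))` and the kernel form on `X = C × Q` -/

/-- The measurable shuffle `((c,q),(c',q')) ↦ ((c,c'),(q,q'))`. -/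
def shuffle (C Q : Type*) [MeasurableSpace C] [MeasurableSpace Q] : (C × Q) × (C × Q) ≃ᵐ (C × C) × (Q × Q) :=
  MeasurableEquiv.prodAssoc.trans <|
    ((MeasurableEquiv.refl C).prodCongr
        (MeasurableEquiv.prodAssoc.symm.trans
          (((MeasurableEquiv.prodComm).prodCongr (MeasurableEquiv.refl Q)).trans MeasurableEquiv.prodAssoc))).trans
      MeasurableEquiv.prodAssoc.symm

omit [MeasurableSpace Z] in
/-- The shuffle on a pair of points of `X = C × Q`. [folklore] -/
theorem shuffle_apply (x x' : C × Q) : shuffle C Q (x, x') = ((x.1, x'.1), (x.2, x'.2)) := rfl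

omit [MeasurableSpace Z] in
/-- The shuffle sends `(ν⊗π)⊗(ν⊗π)` to `(ν⊗ν)⊗(π⊗π)`. [folklore] -/
theorem measurePreserving_shuffle (ν : Measure C) (π : Measure Q) [SFinite ν] [SFinite π] :
    MeasurePreserving (shuffle C Q) ((ν.prod π).prod (ν.prod π)) ((ν.prod ν).prod (π.prod π)) := by
  unfold shuffle
  refine (measurePreserving_prodAssoc ν π (ν.prod π)).trans (MeasurePreserving.trans ?_ ((measurePreserving_prodAssoc ν ν (π.prod π)).symm _))
  refine (MeasurePreserving.id ν).prod ?_
  refine ((measurePreserving_prodAssoc π ν π).symm _).trans (MeasurePreserving.trans ?_ (measurePreserving_prodAssoc ν π π))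
  exact (Measure.measurePreserving_swap (μ := π) (ν := ν)).prod (MeasurePreserving.id π)

omit [MeasurableSpace Z] in
/-- ★ **Reshuffle of a double integral over `X = C × Q`**: `∫_x ∫_{x'} F(x,x') = ∫_c ∫_{c'} ∫_q ∫_{q'} F((c,q),(c',q'))` for `F` integrable on
`(ν⊗π)⊗(ν⊗π)`. [folklore] -/
theorem integral_integral_prod_eq_iterated₄ {F : (C × Q) → (C × Q) → ℝ} (hF : Integrable (Function.uncurry F) ((ν.prod π).prod (ν.prod π))) :
    ∫ x, ∫ x', F x x' ∂(ν.prod π) ∂(ν.prod π) = ∫ c, ∫ c', ∫ q, ∫ q', F (c, q) (c', q') ∂π ∂π ∂ν ∂ν := by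
  -- the shuffled integrand
  set F' : (C × C) × (Q × Q) → ℝ := fun w => F (w.1.1, w.2.1) (w.1.2, w.2.2) with hF'
  have hcomp : (F' ∘ shuffle C Q) = Function.uncurry F := by
    funext p
    obtain ⟨x, x'⟩ := p
    rfl
  have hF'i : Integrable F' ((ν.prod ν).prod (π.prod π)) := by
    rw [← (measurePreserving_shuffle ν π).integrable_comp_emb (shuffle C Q).measurableEmbedding, hcomp]
    exact hF
  -- left side = integral over the big product = integral of F'
  rw [integral_integral hF]
  have h1 : ∫ p, F p.1 p.2 ∂((ν.prod π).prod (ν.prod π)) = ∫ w, F' w ∂((ν.prod ν).prod (π.prod π)) := by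
    rw [← (measurePreserving_shuffle ν π).integral_comp' F']
    exact integral_congr_ae (ae_of_all _ fun p => rfl)
  rw [h1, integral_prod _ hF'i]
  -- now peel `(c,c')` and `(q,q')`
  rw [integral_prod _ hF'i.integral_prod_left]
  refine integral_congr_ae ?_
  have hae := hF'i.prod_right_ae
  filter_upwards [Measure.ae_ae_of_ae_prod hae] with c hc
  refine integral_congr_ae ?_
  filter_upwards [hc] with c' hc'
  rw [integral_prod _ hc']

/-- ★★ **Kernel form ⇒ Gram form**: for the fibred kernel `K(x,x') = k(c,c')·∫ s(c,q,z)s(c',q',z)dρ` on `X = C × Q` (measure `ν⊗π`),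
`∫_x ∫_{x'} Φ(x)K(x,x')Ψ(x') = T(Φ,Ψ)` — so the blocks of `…FibredBOBlocks/…FibredBOCross` apply to the kernel operator.  Hypotheses: the kernel
integrand is integrable on `X × X`, and fibre by fibre the Gram integrand is integrable on `(Q × Q) × Z`. [folklore] -/
theorem integral_fibredKernel_eq_fibredForm (Φ Ψ : C × Q → ℝ)
    (hK : Integrable (fun p : (C × Q) × (C × Q) => Φ p.1 * fibredKernel ρ k s p.1 p.2 * Ψ p.2) ((ν.prod π).prod (ν.prod π)))
    (hG : ∀ c c', Integrable (fun w : (Q × Q) × Z => (s c w.1.1 w.2 * Φ (c, w.1.1)) * (s c' w.1.2 w.2 * Ψ (c', w.1.2))) ((π.prod π).prod ρ)) :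
    ∫ x, ∫ x', Φ x * fibredKernel ρ k s x x' * Ψ x' ∂(ν.prod π) ∂(ν.prod π) = fibredForm ν π ρ k s Φ Ψ := by
  rw [fibredForm_eq_iterated Φ Ψ hG]
  exact integral_integral_prod_eq_iterated₄ (F := fun x x' => Φ x * fibredKernel ρ k s x x' * Ψ x') hK

end Summit.QuantumFields.YangMills.Theorems.FemtoTransferGap.FibredBO

end
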